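import Summits.BirchSwinnertonDyer.BirchSwinnertonDyer.Theorems.KolyvaginRankRigidityAtTwoRingClassNoTwoTorsion
import Literature.NumberTheory.EllipticCurves.ArtinFormalismQuadraticLocalProofs
import HarnessLib

/-!
# Crux V2♭ `KolyvaginCorankLowerBoundAtTwo` (stmt-BirchSwinnertonDyer-24623), line `kolyvagin_depth_split`:
# the binder `d_K · Δ_E ∉ ℚ^{×2}` of the Čebotarev-at-`2` theorems HOLDS ON THE HABITAT
# (helper, PROVED; width seat `bsd-line-krr2-p2` g6)

The one-class Čebotarev theorems at `2` (`…ChebotarevOneClassAtTwo*`, and GK2's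
`GenusExact.equivariantChebotarevAtTwo_of_not_isSquare`) carry the binder
`¬ IsSquare ((d_K : ℚ) · Δ_E)` (equivalently `K ≠ ℚ(√Δ_E)`, i.e. `ρ̄_{E,2}(Γ_K) = GL₂(𝔽₂)`). On the
habitat of V2♭ — `W` globally minimal with `ρ̄_{E,2}` onto, `K` imaginary quadratic with `2 ∤ d_K`
satisfying the Heegner hypothesis for `N_E` — it is AUTOMATIC
(`not_isSquare_discr_mul_Δ_of_heegner`): write `Δ_min = d·s²` with `d` square-free
(`KolyvaginRankRigidity.exists_Δ_eq_squarefree_mul_sq`); `d = 1` contradicts surjectivity mod `2`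
(Dokchitser–Dokchitser), `d = -1` puts `√-1` in `K` and forces `2 ∣ d_K`
(`two_dvd_discr_of_sq_eq_neg_one`, Mathlib's `disc ℚ(i) = -4 ∣ disc K`), and a prime `q ∣ d`
divides `N_E`, hence splits in `K` (Heegner) and `q ∤ d_K`, so `q ∥ d_K·d` is not a square.
HONEST FRAMING: bookkeeping helper (`--supports` 24623); BSD is not proved by any of this.

References: [GrossLMS1991] §3 (3.1); [Kolyvagin1989] Thm. B (the exclusion `K ≠ ℚ(√Δ)`);
[DokchitserDokchitserMathZ2012] Thm. (1); [SilvermanAEC2009] VIII.11.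
-/

set_option autoImplicit false
-- the Theorems namespace of this sub repeats the summit name by design (D-0017 nested layout)
set_option linter.dupNamespace false

noncomputable section

open scoped Classical

namespace Summit.BirchSwinnertonDyer.BirchSwinnertonDyer.Theorems.KolyvaginLowerBoundAtTwo

open WeierstrassCurve NumberField
open Literature.NumberTheory.EllipticCurves

universe u

/-- `i² = −1` in a field of characteristic `0` makes `i` a primitive `4`-th root of unity.
(Adapted from the tree's `Summits/ABC/IUTFork/Joshi/ATS4Reading3DiscTwoPart.lean`.) [folklore] -/
theorem isPrimitiveRoot_four_of_sq_eq_neg_one {K : Type u} [Field K] [CharZero K] {i : K}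
    (hi : i ^ 2 = -1) : IsPrimitiveRoot i 4 := by
  refine IsPrimitiveRoot.mk_of_lt i (by norm_num) ?_ ?_
  · calc i ^ 4 = (i ^ 2) ^ 2 := by ring
      _ = 1 := by rw [hi]; norm_num
  · intro l hl0 hl4 h
    interval_cases l
    · rw [pow_one] at h
      rw [h] at hi
      norm_num at hi
    · rw [hi] at h
      norm_num at h
    · have h' : i ^ 3 = i ^ 2 * i := by ring
      rw [h', hi] at h
      have : i = -1 := by linear_combination -h
      rw [this] at hi
      norm_num at hi

/-- **`2` divides the discriminant of every number field containing `√−1`** (`ℚ(i) ⊆ K`,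
`disc ℚ(i) = −4`, `disc ℚ(i) ∣ disc K`; adapted from the tree's ABC-side lemma of the same name).
[folklore] -/
theorem two_dvd_discr_of_sq_eq_neg_one {K : Type u} [Field K] [NumberField K] {i : K}
    (hi : i ^ 2 = -1) : (2 : ℤ) ∣ discr K := by
  have hζ : IsPrimitiveRoot i (2 ^ (1 + 1)) := by
    rw [show (2 : ℕ) ^ (1 + 1) = 4 by norm_num]
    exact isPrimitiveRoot_four_of_sq_eq_neg_one hi
  haveI : Fact (2 : ℕ).Prime := ⟨Nat.prime_two⟩
  haveI : NeZero (2 ^ (1 + 1) : ℕ) := ⟨by norm_num⟩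
  let K₀ : Type u := ↥(IntermediateField.adjoin ℚ ({i} : Set K))
  haveI : IsCyclotomicExtension {2 ^ (1 + 1)} ℚ K₀ :=
    IsPrimitiveRoot.intermediateField_adjoin_isCyclotomicExtension (K := ℚ) hζ
  have h0 := IsCyclotomicExtension.Rat.discr_prime_pow_succ 2 1 K₀
  have h1 : (2 : ℤ) ∣ discr K₀ := by
    rw [h0]
    norm_num
  exact h1.trans (NumberField.discr_dvd_discr K₀ K)

/-- **On the Heegner habitat with `2 ∤ d_K`, `d_K · Δ_E` is not a rational square** (so
`K ≠ ℚ(√Δ_E)` and `ρ̄_{E,2}(Γ_K) = GL₂(𝔽₂)`): the binder `hns` of the Čebotarev-at-`2` theorems.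
[cite: GrossLMS1991, §3 (3.1)] [cite: DokchitserDokchitserMathZ2012, Thm. (1)]
[cite: SilvermanAEC2009, VIII.11] -/
theorem not_isSquare_discr_mul_Δ_of_heegner (W : WeierstrassCurve ℚ) [W.IsElliptic]
    [W.IsGloballyMinimal] (hs : W.HasSurjectiveModNGaloisRep 2) {K : Type} [Field K]
    [NumberField K] (hK : IsImaginaryQuadratic K) (hodd : ¬ (2 : ℤ) ∣ NumberField.discr K)
    (hH : SatisfiesHeegnerHypothesis (W.conductorNorm ℤ) K) :
    ¬ IsSquare ((NumberField.discr K : ℚ) * W.Δ) := by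
  obtain ⟨d, s, hdsq, hs0, hΔ, hbad⟩ := KolyvaginRankRigidity.exists_Δ_eq_squarefree_mul_sq W
  rintro ⟨r, hr⟩
  have hsQ : (s : ℚ) ≠ 0 := by exact_mod_cast hs0
  -- `d_K · d = (r/s)²` is a rational, hence an integral, square
  have hdd : (((NumberField.discr K * d : ℤ)) : ℚ) = (r / s) * (r / s) := by
    have h1 : (NumberField.discr K : ℚ) * W.Δ = (NumberField.discr K : ℚ) * d * (s : ℚ) ^ 2 := by
      rw [hΔ]; ring
    rw [h1] at hr
    push_cast
    field_simp
    linear_combination hr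
  have hsqZ : IsSquare (NumberField.discr K * d) :=
    Rat.isSquare_intCast_iff.mp ⟨r / s, hdd⟩
  obtain ⟨m, hm⟩ := hsqZ
  have hdK0 : NumberField.discr K < 0 := IsImaginaryQuadratic.discr_neg hK
  by_cases hd1 : d.natAbs = 1
  · rcases Int.natAbs_eq d with hd | hd <;> rw [hd1, Nat.cast_one] at hd
    · -- `d = 1`: `d_K = m² ≥ 0`, but `d_K < 0` … unless we first use surjectivity: `Δ = s²` is a square
      exact ((hasSurjectiveModNGaloisRep_two_iff W).mp hs).2 ⟨s, by rw [hΔ, hd]; ring⟩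
    · -- `d = -1`: `-d_K = m²`, so `√-1 = θ/m ∈ K` with `θ² = d_K`, forcing `2 ∣ d_K`
      rw [hd, mul_neg, mul_one] at hm
      obtain ⟨θ, -, hθ⟩ := exists_sq_eq_discr_not_mem_range K hK.1
      have hθ' : θ ^ 2 = (NumberField.discr K : K) := by
        rw [hθ, map_intCast]
      have hdKK : (NumberField.discr K : K) ≠ 0 := by exact_mod_cast hdK0.ne
      apply hodd
      apply two_dvd_discr_of_sq_eq_neg_one (i := θ / m)
      have hmK : ((m : K)) ^ 2 = -(NumberField.discr K : K) := by
        have := congrArg (fun z : ℤ ↦ (z : K)) hm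
        push_cast at this
        linear_combination -this
      rw [div_pow, hθ', hmK, div_neg, div_self hdKK]
  · -- `d` has a prime factor `q`: `q ∣ N_E`, so `q ∤ d_K` (Heegner), and `q ∥ d`: `d_K d` is no square
    obtain ⟨q, hq, hqd⟩ := Nat.exists_prime_and_dvd hd1
    have hqdZ : (q : ℤ) ∣ d := Int.natCast_dvd.mpr hqd
    have hqZ : Prime (q : ℤ) := Nat.prime_iff_prime_int.mp hq
    have hqN : q ∣ W.conductorNorm ℤ := hbad q hq hqdZ
    have hqK : ¬ (q : ℤ) ∣ NumberField.discr K :=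
      not_dvd_discr_of_ncard_primesOver_eq_two hK.1 hq (hH q hq hqN)
    -- `q ∣ m`, then `q² ∣ d_K d`, then `q² ∣ d`
    obtain ⟨d', rfl⟩ := hqdZ
    have hqm : (q : ℤ) ∣ m := by
      have : (q : ℤ) ∣ m * m := ⟨NumberField.discr K * d', by rw [← hm]; ring⟩
      exact (hqZ.dvd_mul.mp this).elim id id
    obtain ⟨m', rfl⟩ := hqm
    have h2 : NumberField.discr K * d' = q * (m' * m') := by
      have hq0 : (q : ℤ) ≠ 0 := by exact_mod_cast hq.ne_zero
      have := hm
      rw [show NumberField.discr K * (↑q * d') = q * (NumberField.discr K * d') by ring,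
        show (↑q * m') * (↑q * m') = q * (q * (m' * m')) by ring] at this
      exact mul_left_cancel₀ hq0 this
    have hqd' : (q : ℤ) ∣ d' := by
      have : (q : ℤ) ∣ NumberField.discr K * d' := ⟨m' * m', h2⟩
      exact ((hqZ.dvd_mul.mp this).resolve_left hqK)
    obtain ⟨d'', rfl⟩ := hqd'
    have hunit : IsUnit (q : ℤ) := hdsq q ⟨d'', by ring⟩
    rw [Int.isUnit_iff_natAbs_eq, Int.natAbs_natCast] at hunit
    exact hq.one_lt.ne' hunit

end Summit.BirchSwinnertonDyer.BirchSwinnertonDyer.Theorems.KolyvaginLowerBoundAtTwo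

end
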